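import Literature.AlgebraicTopology.SingularHomology.PoincareDualityCorollaries
import Literature.AlgebraicTopology.SingularHomology.UniversalCoefficientsFree
import Literature.AlgebraicTopology.SingularHomology.FundamentalClassExistence
import Literature.AlgebraicTopology.SingularHomology.OrientationCover
import Literature.AlgebraicTopology.SingularHomology.MayerVietorisExactness
import Literature.AlgebraicTopology.SingularHomology.ExcisionTheorem
import Literature.AlgebraicTopology.SingularHomology.LocalHomologyUniverse
import Literature.AlgebraicTopology.SingularHomology.CupProductProofs
import Literature.AlgebraicTopology.FundamentalGroup.SphereSimplyConnected
import Literature.Topology.FourManifolds.GluckTwistSimplyConnected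
import Literature.Topology.FourManifolds.ClosedModelRelOrientation
import Literature.Topology.FourManifolds.HomotopySpheresBPOrderSignatureProofs
import Literature.Topology.FourManifolds.HomotopySpheresE8GramReduction
import Literature.AlgebraicTopology.SingularHomology.SimplyConnectedH1
import Literature.AlgebraicTopology.SingularHomology.LinearLocalDegree
import Literature.AlgebraicTopology.SingularHomology.ContractiblePunctured
import Literature.AlgebraicTopology.SingularHomology.SuspensionIsomorphism
import Literature.AlgebraicTopology.SingularHomology.CohomologyHomotopyInvariance
import HarnessLib

/-!
# The cohomology ring of `Sᵏ × Sᵏ` in the middle dimension, through Poincaré duality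

Topic `Literature/Topology/FourManifolds` (fact seat of
`Literature.Topology.FourManifolds.HomotopySphere.exists_intersectionForm_equivalent_e8Form`,
Kosinski's `E₈` plumbing `M(4m)`: the product `S²ᵐ × S²ᵐ` is the local model of the plumbing —
a neighbourhood of the diagonal is the tangent disc bundle of `S²ᵐ`, two factors through a point
cross transversally once — in which the intersection numbers `±2` (diagonal) and `±1` (crossing)
are read off as cup products). A. Hatcher, *Algebraic Topology* (2002), Example 3.11 / Thm. 3.15
(Künneth): `H*(Sᵏ × Sᵏ; ℤ) = ℤ[α, β]/(α², β²)`, `|α| = |β| = k`, with `αβ` a generator of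
`H²ᵏ`. The tree has no Künneth theorem and no cross product; here the middle-dimensional part of
this ring is obtained from what the tree has — Mayer–Vietoris, the exact sequence of the pair,
universal coefficients and **Poincaré duality** (Hatcher Cor. 3.39: the cup-product form of a closed
oriented manifold is unimodular). Everything is **proved**; there are no named facts (D-0026).

For `k ≥ 2`, `S = Sᵏ ⊆ ℝᵏ⁺¹` the unit sphere, `X = S × S`, `pr₁, pr₂ : X → S` the projections,
`ι₁ x = (x, s)`, `ι₂ x = (s, x)` the two factors through the south pole `s`, `γ ∈ Hᵏ(S; ℤ)` the
class with `⟨γ, [S]⟩ = 1` and `g₁ = pr₁^* γ`, `g₂ = pr₂^* γ`: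

* `SphereProd.chartedSpace` — `X` as a closed topological `2k`-manifold charted on `ℝ²ᵏ`
  (product atlas followed by a linear change of model `ℝᵏ × ℝᵏ ≃ ℝ²ᵏ`), a `def` used locally;
  `SphereProd.isOrientableOver` — `X` is `ℤ`-orientable (simply connected, Hatcher Prop. 3.25).
* `SphereProd.kroneckerPairing_g_y` — `⟨gₐ, ι_b₊[S]⟩ = δ_{ab}` (the classes `yₐ = ιₐ₊[S]`, indexed
  by `Fin 2`: `ι 0 = ι₁`, `ι 1 = ι₂`, `g 0 = g₁`, `g 1 = g₂`).
* `SphereProd.cupProduct_g_self` — `gₐ ⌣ gₐ = 0` (`H²ᵏ(Sᵏ; ℤ) = 0`).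
* `SphereProd.exists_eq_sum_smul_y` — `ι₁₊[S]`, `ι₂₊[S]` generate `Hₖ(X; ℤ)`;
  `SphereProd.isZero_singularHomology_pred` — `Hₖ₋₁(X; ℤ) = 0` (Mayer–Vietoris for
  `X ∖ (n, n) = (S ∖ n) × S ∪ S × (S ∖ n)`, whose intersection is contractible and whose pieces
  deformation retract onto the factors, then the exact sequence of the pair `(X, X ∖ (n, n))`, whose
  relative groups are local homology groups of the `2k`-manifold `X`; for `k = 2`, `H₁ = 0` by
  simple connectivity); `SphereProd.injective_evalH` — a class of `Hᵏ(X; ℤ)` is determined by its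
  values on the two factors (universal coefficients, Thm. 3.2).
* `SphereProd.exists_basis_freeCohomology`, `SphereProd.finrank_freeCohomology` — `ḡ₁, ḡ₂` is a
  basis of `Hᵏ(X; ℤ)/T ≅ ℤ²` (detected by the factors; `exists_basis_of_isUnit_eval`).
* `SphereProd.abs_cupPairing_g`, `SphereProd.abs_cupPairing_g'`, `SphereProd.cupPairing_g_self` —
  **`|⟨g₁ ⌣ g₂, [X]⟩| = 1`**, `⟨gₐ ⌣ gₐ, [X]⟩ = 0` for every `ℤ`-orientation of `X`: the cup-product
  form on `Hᵏ(X; ℤ)/T` is unimodular (Poincaré duality, `isPerfPair_cupPairingModTorsion_holds`)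
  with Gram matrix `(0, x; ±x, 0)` in the basis `ḡ₁, ḡ₂`, so `x = ±1`.

* `SphereProd.map_antipode`, `SphereProd.map_antipode_γ` — the antipodal map of `Sᵏ`, `k ≥ 2`
  even, acts by `-1` on `Hₖ(Sᵏ; ℤ)` and on `γ` (Hatcher §2.2 property (g); from the tree's
  `localHomology_map_continuousLinearMap_of_det_neg` for `-1 ∈ GL(k+1, ℝ)` through the
  connecting isomorphism of `(ℝᵏ⁺¹, ℝᵏ⁺¹ ∖ 0)` and `Sᵏ ≃ ℝᵏ⁺¹ ∖ 0`).
* `SphereProd.antidiagHomotopy`, `SphereProd.injective_map_antidiag` — the complement of the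
  diagonal deformation retracts onto the antidiagonal `{(x, -x)}` (Milnor–Stasheff §11, proof of
  Thm. 11.1), so restriction to the antidiagonal is injective in cohomology.
* `SphereProd.map_compl_diagonal_g_add_g` — **`(g₁ + g₂)|_{Sᵏ × Sᵏ ∖ Δ} = 0`** for `k` even (on
  the antidiagonal it is `γ + antipode^* γ = 0`): the input for lifting `g₁ + g₂`, the Poincaré
  dual of the diagonal, to a class supported on the diagonal; `SphereProd.map_compl_slice_g_zero/one`
  — `g₁` (`g₂`) vanishes off every slice `{p} × Sᵏ` (`Sᵏ × {p}`).

Also two general lemmas: `SphereProd.sndHomotopyEquiv` / `SphereProd.isIso_map_sliceMap` (a slice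
`y ↦ (c₀, y)` into a product with a contractible factor is a homotopy equivalence) and
`SphereProd.exists_kroneckerPairing_fundamentalClass_eq_one` (on a closed connected oriented
manifold some class pairs to `1` with the fundamental class).

## References

* A. Hatcher, *Algebraic Topology*, CUP 2002: Example 3.11 and Thm. 3.15 (the ring
  `H*(Sᵏ × Sᵏ)`), §2.2 pp. 149–150 (Mayer–Vietoris), Thm. 3.2 (universal coefficients),
  Prop. 3.25, Thm. 3.26, Cor. 3.39. [HatcherAT2002]
* A. Kosinski, *Differential Manifolds* (1993), VI.12 ((12.3), (12.4): the intersection numbers of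
  the plumbing). [Kosinski1993]
* J. Milnor, J. Stasheff, *Characteristic classes* (1974), §11, Thm. 11.1 and its proof (the
  complement of the diagonal retracts onto the antidiagonal; the dual class of the diagonal).
  [MilnorStasheff1974]
-/

open scoped Manifold ContDiff Topology
open Set Function CategoryTheory CategoryTheory.Limits

noncomputable section

universe u

namespace Literature.Topology.FourManifolds

open Literature.AlgebraicTopology.SingularHomology

/-- Local notation: `𝔼 n` is the model Euclidean space `EuclideanSpace ℝ (Fin n)`. -/
local notation "𝔼 " n:arg => EuclideanSpace ℝ (Fin n)

/-- Local notation: `𝕊 n` is the unit sphere in `EuclideanSpace ℝ (Fin (n + 1))`. -/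
local notation "𝕊 " n:arg => (Metric.sphere (0 : EuclideanSpace ℝ (Fin (n + 1))) 1)


namespace SphereProd

variable (k : ℕ)

/-! ### `Sᵏ × Sᵏ` as a closed topological `2k`-manifold charted on `ℝ²ᵏ` -/

/-- The linear change of model `ℝᵏ × ℝᵏ ≃L ℝᵏ⁺ᵏ` (dimension count). [folklore] -/
def modelLin : (𝔼 k × 𝔼 k) ≃L[ℝ] 𝔼 (k + k) :=
  ContinuousLinearEquiv.ofFinrankEq (by simp [Module.finrank_prod])

/-- The change of model space `ModelProd ℝᵏ ℝᵏ ≃ₜ ℝᵏ⁺ᵏ` underlying `modelLin`. [folklore] -/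
def modelHomeo : ModelProd (𝔼 k) (𝔼 k) ≃ₜ 𝔼 (k + k) :=
  (modelLin k).toHomeomorph

/-- **`Sᵏ × Sᵏ` charted on `ℝ²ᵏ`**: the product atlas (charts valued in `ModelProd ℝᵏ ℝᵏ`)
followed by the linear homeomorphism `ModelProd ℝᵏ ℝᵏ ≃ₜ ℝᵏ⁺ᵏ`. A `def`, not an instance (the
product already carries its `ModelProd`-valued atlas); used locally to apply the tree's theorems on
closed topological manifolds (Poincaré duality, local homology). (Lee 2013, Example 1.8 / 1.34:
products of manifolds.) [folklore] -/
@[reducible] def chartedSpace : ChartedSpace (𝔼 (k + k)) ((𝕊 k) × (𝕊 k)) where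
  atlas := (fun c => c ≫ₕ (modelHomeo k).toOpenPartialHomeomorph) ''
    atlas (ModelProd (𝔼 k) (𝔼 k)) ((𝕊 k) × (𝕊 k))
  chartAt x := chartAt (ModelProd (𝔼 k) (𝔼 k)) x ≫ₕ (modelHomeo k).toOpenPartialHomeomorph
  mem_chart_source x := by simp
  chart_mem_atlas x := mem_image_of_mem _ (chart_mem_atlas _ x)

variable {k}

/-- `Sᵏ` is simply connected for `k ≥ 2` (Hatcher Prop. 1.14; tree theorem). [cite: HatcherAT2002, Prop. 1.14] -/
theorem simplyConnectedSpace_sphere (hk : 2 ≤ k) : SimplyConnectedSpace (𝕊 k) :=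
  Literature.AlgebraicTopology.FundamentalGroup.simplyConnectedSpace_euclideanSphere k hk

/-- `Sᵏ × Sᵏ` is simply connected for `k ≥ 2`. [cite: HatcherAT2002, Prop. 1.12 and Prop. 1.14] -/
theorem simplyConnectedSpace (hk : 2 ≤ k) : SimplyConnectedSpace ((𝕊 k) × (𝕊 k)) :=
  haveI := simplyConnectedSpace_sphere hk
  simplyConnectedSpace_prod

/-- **`Sᵏ × Sᵏ` is `ℤ`-orientable** (`k ≥ 2`): a simply connected manifold is orientable
(Hatcher Prop. 3.25; tree theorem `isOrientableOver_of_simplyConnectedSpace`). [cite: HatcherAT2002, Prop. 3.25] -/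
theorem isOrientableOver (hk : 2 ≤ k) : IsOrientableOver ℤ ((𝕊 k) × (𝕊 k)) (k + k) := by
  letI := chartedSpace k
  haveI := simplyConnectedSpace hk
  exact isOrientableOver_of_simplyConnectedSpace ℤ ((𝕊 k) × (𝕊 k))

/-- `Sᵏ` is `ℤ`-orientable (`k ≥ 2`). [cite: HatcherAT2002, Prop. 3.25] -/
theorem isOrientableOver_sphere (hk : 2 ≤ k) : IsOrientableOver ℤ (𝕊 k) k := by
  haveI := simplyConnectedSpace_sphere hk
  exact isOrientableOver_of_simplyConnectedSpace ℤ (𝕊 k)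

/-! ### The two factors and the two projections -/

/-- The south pole `s = -e_k ∈ Sᵏ` (base point of the two factors). [folklore] -/
def southPole (k : ℕ) : 𝕊 k :=
  ⟨-EuclideanSpace.single (Fin.last k) 1, by simp⟩

variable (k) in
/-- The first factor `ι₁ : Sᵏ → Sᵏ × Sᵏ`, `x ↦ (x, s)`. [folklore] -/
def ι₁ : C(𝕊 k, (𝕊 k) × (𝕊 k)) := ⟨fun x => (x, southPole k), by fun_prop⟩

variable (k) in
/-- The second factor `ι₂ : Sᵏ → Sᵏ × Sᵏ`, `x ↦ (s, x)`. [folklore] -/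
def ι₂ : C(𝕊 k, (𝕊 k) × (𝕊 k)) := ⟨fun x => (southPole k, x), by fun_prop⟩

variable (k) in
/-- The first projection `pr₁ : Sᵏ × Sᵏ → Sᵏ`. [folklore] -/
def pr₁ : C((𝕊 k) × (𝕊 k), 𝕊 k) := ⟨Prod.fst, continuous_fst⟩

variable (k) in
/-- The second projection `pr₂ : Sᵏ × Sᵏ → Sᵏ`. [folklore] -/
def pr₂ : C((𝕊 k) × (𝕊 k), 𝕊 k) := ⟨Prod.snd, continuous_snd⟩

/-- The factor (`ι₁` for `a = 0`, `ι₂` for `a = 1`). [folklore] -/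
def ι (k : ℕ) : Fin 2 → C(𝕊 k, (𝕊 k) × (𝕊 k)) := ![ι₁ k, ι₂ k]

/-- The projection (`pr₁` for `a = 0`, `pr₂` for `a = 1`). [folklore] -/
def pr (k : ℕ) : Fin 2 → C((𝕊 k) × (𝕊 k), 𝕊 k) := ![pr₁ k, pr₂ k]

/-- `ι 0 = ι₁`. [folklore] -/
@[simp] theorem ι_zero : ι k 0 = ι₁ k := rfl

/-- `ι 1 = ι₂`. [folklore] -/
@[simp] theorem ι_one : ι k 1 = ι₂ k := rfl

/-- `pr 0 = pr₁`. [folklore] -/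
@[simp] theorem pr_zero : pr k 0 = pr₁ k := rfl

/-- `pr 1 = pr₂`. [folklore] -/
@[simp] theorem pr_one : pr k 1 = pr₂ k := rfl

/-- `prₐ ∘ ιₐ = id`. [folklore] -/
theorem pr_comp_ι_self (a : Fin 2) : (pr k a).comp (ι k a) = ContinuousMap.id (𝕊 k) := by
  fin_cases a <;> rfl

/-- `prₐ ∘ ι_b` is constant (the south pole) for `a ≠ b`. [folklore] -/
theorem pr_comp_ι_of_ne {a b : Fin 2} (hab : a ≠ b) :
    (pr k a).comp (ι k b) = ContinuousMap.const (𝕊 k) (southPole k) := by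
  fin_cases a <;> fin_cases b <;> first | exact absurd rfl hab | rfl

/-! ### The fundamental class of `Sᵏ` generates, and its dual class `γ` -/

section Sphere

variable {Y : Type} [TopologicalSpace Y] [CompactSpace Y] [T2Space Y] [ConnectedSpace Y] {n : ℕ}
  [ChartedSpace (𝔼 n) Y]

/-- **On a closed connected oriented `n`-manifold there is a functional `Hₙ(Y; ℤ) → ℤ` taking the
value `1` on the fundamental class** (Hatcher Thm. 3.26(a): `Hₙ(Y; ℤ) → Hₙ(Y | y; ℤ) ≅ ℤ` is an
isomorphism taking `[Y]` to the local orientation generator). [cite: HatcherAT2002, Thm. 3.26(a)] -/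
theorem exists_linearMap_fundamentalClass_eq_one (μ : HomologicalOrientation ℤ Y n) :
    ∃ f : ↥(singularHomology ℤ ℤ Y n) →ₗ[ℤ] ℤ, f μ.fundamentalClass = 1 := by
  obtain ⟨y⟩ := (inferInstance : Nonempty Y)
  obtain ⟨e, he⟩ := μ.isGenerator y
  have hfc := HomologicalOrientation.isFundamentalClass_fundamentalClass_holds (R := ℤ) (X := Y) n μ
  refine ⟨e.toLinearMap ∘ₗ (singularHomology.toLocal ℤ ℤ y n).hom, ?_⟩
  rw [LinearMap.comp_apply]
  change e (singularHomology.toLocal ℤ ℤ y n μ.fundamentalClass) = 1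
  rw [hfc y, he]

/-- **The dual class of the fundamental class**: on a closed connected oriented `n`-manifold, `n ≥ 1`,
there is `γ ∈ Hⁿ(Y; ℤ)` with `⟨γ, [Y]⟩ = 1` (universal coefficients: the Kronecker map
`Hⁿ → Hom(Hₙ, ℤ)` is onto, Hatcher Thm. 3.2; applied to the functional of
`exists_linearMap_fundamentalClass_eq_one`). [cite: HatcherAT2002, Thm. 3.2 and Thm. 3.26(a)] -/
theorem exists_kroneckerPairing_fundamentalClass_eq_one (hn : 1 ≤ n)
    (μ : HomologicalOrientation ℤ Y n) :
    ∃ γ : ↥(singularCohomology ℤ ℤ Y n), kroneckerPairing ℤ ℤ Y n γ μ.fundamentalClass = 1 := by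
  obtain ⟨f, hf⟩ := exists_linearMap_fundamentalClass_eq_one μ
  obtain ⟨m, rfl⟩ : ∃ m, n = m + 1 := ⟨n - 1, by omega⟩
  obtain ⟨γ, hγ⟩ := kroneckerPairing_surjective ℤ Y (m + 1) f
  exact ⟨γ, by rw [hγ, hf]⟩

end Sphere

/-- An orientation of `Sᵏ` (`k ≥ 2`), chosen once and for all. [folklore] -/
def μS (hk : 2 ≤ k) : HomologicalOrientation ℤ (𝕊 k) k := (isOrientableOver_sphere hk).some

/-- **The dual class `γ ∈ Hᵏ(Sᵏ; ℤ)` of the fundamental class, `⟨γ, [Sᵏ]⟩ = 1`** (chosen).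
[cite: HatcherAT2002, Thm. 3.2 and Thm. 3.26(a)] -/
def γ (hk : 2 ≤ k) : ↥(singularCohomology ℤ ℤ (𝕊 k) k) :=
  haveI : ConnectedSpace (𝕊 k) := by
    haveI := simplyConnectedSpace_sphere hk
    infer_instance
  (exists_kroneckerPairing_fundamentalClass_eq_one (Y := 𝕊 k) (by omega) (μS hk)).choose

/-- `⟨γ, [Sᵏ]⟩ = 1`. [cite: HatcherAT2002, Thm. 3.26(a)] -/
theorem kroneckerPairing_γ (hk : 2 ≤ k) :
    kroneckerPairing ℤ ℤ (𝕊 k) k (γ hk) (μS hk).fundamentalClass = 1 := by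
  haveI : ConnectedSpace (𝕊 k) := by
    haveI := simplyConnectedSpace_sphere hk
    infer_instance
  exact (exists_kroneckerPairing_fundamentalClass_eq_one (Y := 𝕊 k) (by omega) (μS hk)).choose_spec

/-- **`Hⱼ(Sᵏ; ℤ) = 0` for `j ≠ 0, k`** (Hatcher Cor. 2.14; tree theorem). [cite: HatcherAT2002, Cor. 2.14] -/
theorem isZero_singularHomology_sphere {j : ℕ} (hj : j ≠ 0) (hjk : j ≠ k) :
    IsZero (singularHomology ℤ ℤ (𝕊 k) j) :=
  isZero_singularHomology_sphere_holds ℤ ℤ hj hjk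

/-- A constant self-map of `Sᵏ` kills `Hₖ(Sᵏ; ℤ)` (`k ≥ 1`): it factors through a point.
[cite: HatcherAT2002, §2.1 Prop. 2.8] -/
theorem map_const_eq_zero (hk : 1 ≤ k) (p : 𝕊 k) :
    singularHomology.map ℤ ℤ (ContinuousMap.const (𝕊 k) p) k = 0 := by
  have hfac : ContinuousMap.const (𝕊 k) p =
      (ContinuousMap.const PUnit.{1} p).comp (ContinuousMap.const (𝕊 k) PUnit.unit) := rfl
  rw [hfac, singularHomology.map_comp]
  have h0 : IsZero (singularHomology ℤ ℤ PUnit.{1} k) :=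
    isZero_singularHomology_of_subsingleton ℤ ℤ (X := PUnit.{1}) (by omega)
  rw [h0.eq_of_src (singularHomology.map ℤ ℤ (ContinuousMap.const PUnit.{1} p) k) 0, comp_zero]

/-! ### The classes `g₁ = pr₁^* γ`, `g₂ = pr₂^* γ` and their Kronecker values on the factors -/

/-- **The classes `gₐ = prₐ^* γ ∈ Hᵏ(Sᵏ × Sᵏ; ℤ)`** (`a = 0, 1`; Hatcher Example 3.11: `α`, `β`).
[cite: HatcherAT2002, Example 3.11] -/
def g (hk : 2 ≤ k) (a : Fin 2) : ↥(singularCohomology ℤ ℤ ((𝕊 k) × (𝕊 k)) k) :=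
  singularCohomology.map ℤ ℤ (pr k a) k (γ hk)

/-- **The homology classes `yₐ = ιₐ₊[Sᵏ] ∈ Hₖ(Sᵏ × Sᵏ; ℤ)`** of the two factors. [cite: HatcherAT2002, Example 3.11] -/
def y (hk : 2 ≤ k) (a : Fin 2) : ↥(singularHomology ℤ ℤ ((𝕊 k) × (𝕊 k)) k) :=
  singularHomology.map ℤ ℤ (ι k a) k (μS hk).fundamentalClass

/-- **`⟨gₐ, ιₐ₊[S]⟩ = 1`**: `prₐ ∘ ιₐ = id` and `⟨γ, [S]⟩ = 1`. [cite: HatcherAT2002, Example 3.11 and §3.1 p. 201 (naturality)] -/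
theorem kroneckerPairing_g_y_self (hk : 2 ≤ k) (a : Fin 2) :
    kroneckerPairing ℤ ℤ ((𝕊 k) × (𝕊 k)) k (g hk a) (y hk a) = 1 := by
  rw [g, y, kroneckerPairing_map, ← ModuleCat.comp_apply, ← singularHomology.map_comp,
    pr_comp_ι_self, singularHomology.map_id, ModuleCat.id_apply, kroneckerPairing_γ]

/-- **`⟨gₐ, ι_b₊[S]⟩ = 0` for `a ≠ b`**: `prₐ ∘ ι_b` is constant. [cite: HatcherAT2002, Example 3.11 and §3.1 p. 201 (naturality)] -/
theorem kroneckerPairing_g_y_of_ne (hk : 2 ≤ k) {a b : Fin 2} (hab : a ≠ b) :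
    kroneckerPairing ℤ ℤ ((𝕊 k) × (𝕊 k)) k (g hk a) (y hk b) = 0 := by
  rw [g, y, kroneckerPairing_map, ← ModuleCat.comp_apply, ← singularHomology.map_comp,
    pr_comp_ι_of_ne hab, map_const_eq_zero (by omega)]
  simp

/-- The Kronecker matrix `⟨gₐ, y_b⟩` is the identity. [cite: HatcherAT2002, Example 3.11] -/
theorem kroneckerPairing_g_y (hk : 2 ≤ k) (a b : Fin 2) :
    kroneckerPairing ℤ ℤ ((𝕊 k) × (𝕊 k)) k (g hk a) (y hk b) = if a = b then 1 else 0 := by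
  split_ifs with h
  · subst h; exact kroneckerPairing_g_y_self hk a
  · exact kroneckerPairing_g_y_of_ne hk h

/-! ### `gₐ ⌣ gₐ = 0` -/

/-- **`H²ᵏ(Sᵏ; ℤ) = 0`** (`k ≥ 2`): by universal coefficients `H²ᵏ ≅ Hom(H₂ₖ, ℤ)`
(`H₂ₖ₋₁(Sᵏ) = 0`, Hatcher Thm. 3.2) and `H₂ₖ(Sᵏ) = 0`. [cite: HatcherAT2002, Thm. 3.2 and Cor. 2.14] -/
theorem isZero_singularCohomology_sphere_add (hk : 2 ≤ k) :
    IsZero (singularCohomology ℤ ℤ (𝕊 k) (k + k)) := by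
  obtain ⟨m, hm⟩ : ∃ m, k + k = m + 1 := ⟨k + k - 1, by omega⟩
  rw [hm]
  have h1 : IsZero (singularHomology ℤ ℤ (𝕊 k) m) :=
    isZero_singularHomology_sphere (by omega) (by omega)
  have h2 : IsZero (singularHomology ℤ ℤ (𝕊 k) (m + 1)) :=
    isZero_singularHomology_sphere (by omega) (by omega)
  have hb := kroneckerPairing_bijective_of_isZero ℤ (𝕊 k) m h1
  haveI := ModuleCat.subsingleton_of_isZero h2
  haveI : Subsingleton ↥(singularCohomology ℤ ℤ (𝕊 k) (m + 1)) := hb.1.subsingleton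
  exact ModuleCat.isZero_of_subsingleton _

/-- **`gₐ ⌣ gₐ = 0`**: `gₐ ⌣ gₐ = prₐ^*(γ ⌣ γ)` and `γ ⌣ γ ∈ H²ᵏ(Sᵏ; ℤ) = 0` (Hatcher
Example 3.11: `α² = β² = 0`). [cite: HatcherAT2002, Example 3.11 and Prop. 3.10 (naturality)] -/
theorem cupProduct_g_self (hk : 2 ≤ k) (a : Fin 2) :
    cupProduct rfl (g hk a) (g hk a) = 0 := by
  rw [g, ← cupProduct_map]
  haveI := ModuleCat.subsingleton_of_isZero (isZero_singularCohomology_sphere_add hk)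
  have h0 : cupProduct (rfl : k + k = k + k) (γ hk) (γ hk) = 0 := Subsingleton.elim _ _
  rw [h0, map_zero]

/-! ### Homotopy lemma: `y ↦ (c₀, y)` into a product with a contractible factor -/

section ContractibleFactor

variable {C Y : Type} [TopologicalSpace C] [TopologicalSpace Y]

/-- Two constant maps into a path-connected space are homotopic (along a path).
[cite: HatcherAT2002, §0 p. 3] -/
def homotopyConst {A : Type} [TopologicalSpace A] [PathConnectedSpace C] (c₀ c₁ : C) :
    ContinuousMap.Homotopy (ContinuousMap.const A c₀) (ContinuousMap.const A c₁) where
  toFun p := (PathConnectedSpace.somePath c₀ c₁) p.1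
  continuous_toFun := (PathConnectedSpace.somePath c₀ c₁).continuous.comp continuous_fst
  map_zero_left a := by simp
  map_one_left a := by simp

/-- The slice `y ↦ (c₀, y)`. [folklore] -/
def sliceMap (c₀ : C) : C(Y, C × Y) := ⟨fun y => (c₀, y), by fun_prop⟩

/-- **`C × Y ≃ₕ Y` by the second projection, with homotopy inverse the slice `y ↦ (c₀, y)`**, for
`C` contractible (Hatcher 2002, §0, Example 0.10 ff.: a contractible factor may be collapsed).
[cite: HatcherAT2002, §0 (contractible spaces, p. 4)] -/
def sndHomotopyEquiv [ContractibleSpace C] (c₀ : C) : ContinuousMap.HomotopyEquiv (C × Y) Y where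
  toFun := ⟨Prod.snd, continuous_snd⟩
  invFun := sliceMap c₀
  left_inv := by
    -- `(c, y) ↦ (c₀, y)` is homotopic to the identity: contract `C` to `c₀` in the first factor
    obtain ⟨c₁, ⟨H₁⟩⟩ := id_nullhomotopic C
    have H : ContinuousMap.Homotopic (ContinuousMap.const C c₀) (ContinuousMap.id C) :=
      ⟨(homotopyConst c₀ c₁).trans H₁.symm⟩
    obtain ⟨F⟩ := H
    refine ⟨?_⟩
    have e0 : (sliceMap c₀).comp ⟨Prod.snd, continuous_snd⟩ =
        ((ContinuousMap.const C c₀).comp ⟨Prod.fst, continuous_fst⟩).prodMk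
          (⟨Prod.snd, continuous_snd⟩ : C(C × Y, Y)) := by ext p <;> rfl
    have e1 : ContinuousMap.id (C × Y) =
        ((ContinuousMap.id C).comp ⟨Prod.fst, continuous_fst⟩).prodMk
          (⟨Prod.snd, continuous_snd⟩ : C(C × Y, Y)) := by ext p <;> rfl
    rw [e0, e1]
    exact (F.compContinuousMap ⟨Prod.fst, continuous_fst⟩).prod (ContinuousMap.Homotopy.refl _)
  right_inv := ⟨ContinuousMap.Homotopy.refl _⟩

/-- **The slice `y ↦ (c₀, y) : Y → C × Y` induces isomorphisms on homology** for `C` contractible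
(it is a homotopy equivalence; Hatcher Cor. 2.11). [cite: HatcherAT2002, Cor. 2.11] -/
theorem isIso_map_sliceMap [ContractibleSpace C] (c₀ : C) (j : ℕ) :
    IsIso (singularHomology.map ℤ ℤ (sliceMap (Y := Y) c₀) j) :=
  isIso_map_of_homotopyEquiv ℤ ℤ (sndHomotopyEquiv (Y := Y) c₀).symm j

end ContractibleFactor

/-! ### The punctured sphere is contractible -/

/-- The north pole `n = e_k ∈ Sᵏ` (the puncture). [folklore] -/
def northPole (k : ℕ) : 𝕊 k :=
  ⟨EuclideanSpace.single (Fin.last k) 1, by simp⟩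

/-- The two poles are distinct. [folklore] -/
theorem southPole_ne_northPole : southPole k ≠ northPole k := by
  intro h
  have h1 := congrArg (fun p : 𝕊 k => (p : 𝔼 (k + 1)) (Fin.last k)) h
  simp [southPole, northPole] at h1
  norm_num at h1

/-- **`Sᵏ ∖ {p}` is contractible**: stereographic projection from `p` is a homeomorphism onto
`ℝᵏ` (Hatcher 2002, Example 0.3 ff.; Mathlib's `stereographic'`). [cite: HatcherAT2002, §0 p. 6 (Sⁿ minus a point ≅ ℝⁿ)] -/
theorem contractibleSpace_compl_singleton (p : 𝕊 k) :
    ContractibleSpace ↥(({p}ᶜ : Set (𝕊 k))) := by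
  haveI : Fact (Module.finrank ℝ (𝔼 (k + 1)) = k + 1) := ⟨finrank_euclideanSpace_fin⟩
  let e := stereographic' (E := 𝔼 (k + 1)) k p
  have hs : e.source = ({p}ᶜ : Set (𝕊 k)) := stereographic'_source p
  have ht : e.target = Set.univ := stereographic'_target p
  let φ : ↥(({p}ᶜ : Set (𝕊 k))) ≃ₜ 𝔼 k :=
    ((Homeomorph.setCongr hs).symm.trans e.toHomeomorphSourceTarget).trans
      ((Homeomorph.setCongr ht).trans (Homeomorph.Set.univ (𝔼 k)))
  exact φ.contractibleSpace

/-! ### The punctured product `X' = Sᵏ × Sᵏ ∖ (n, n)` and its Mayer–Vietoris cover -/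

/-- The puncture `P = (n, n)`. [folklore] -/
def puncture (k : ℕ) : (𝕊 k) × (𝕊 k) := (northPole k, northPole k)

/-- The punctured product `X' = Sᵏ × Sᵏ ∖ {(n, n)}` (as a set). [folklore] -/
def punctSet (k : ℕ) : Set ((𝕊 k) × (𝕊 k)) := {puncture k}ᶜ

/-- The first piece `U = (S ∖ n) × S` of the cover of `X'` (as a subset of `X'`). [folklore] -/
def pieceU (k : ℕ) : Set ↥(punctSet k) := {q | q.1.1 ≠ northPole k}

/-- The second piece `V = S × (S ∖ n)` of the cover of `X'`. [folklore] -/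
def pieceV (k : ℕ) : Set ↥(punctSet k) := {q | q.1.2 ≠ northPole k}

/-- `U` is open. [folklore] -/
theorem isOpen_pieceU : IsOpen (pieceU k) :=
  (isOpen_compl_singleton.preimage continuous_fst).preimage continuous_subtype_val

/-- `V` is open. [folklore] -/
theorem isOpen_pieceV : IsOpen (pieceV k) :=
  (isOpen_compl_singleton.preimage continuous_snd).preimage continuous_subtype_val

/-- `U ∪ V = X'`. [folklore] -/
theorem pieceU_union_pieceV : pieceU k ∪ pieceV k = Set.univ := by
  refine Set.eq_univ_of_forall fun q => ?_
  by_contra h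
  simp only [Set.mem_union, pieceU, pieceV, Set.mem_setOf_eq, not_or, not_not] at h
  exact q.2 (Prod.ext h.1 h.2)

/-- The interiors of `U`, `V` cover `X'` (both are open). [folklore] -/
theorem interior_pieceU_union : interior (pieceU k) ∪ interior (pieceV k) = Set.univ := by
  rw [isOpen_pieceU.interior_eq, isOpen_pieceV.interior_eq, pieceU_union_pieceV]

/-- `U ∩ V ≅ (S ∖ n) × (S ∖ n)`. [folklore] -/
def interHomeomorph :
    ↥(pieceU k ∩ pieceV k) ≃ₜ ↥(({northPole k}ᶜ : Set (𝕊 k))) × ↥(({northPole k}ᶜ : Set (𝕊 k))) where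
  toFun q := (⟨q.1.1.1, q.2.1⟩, ⟨q.1.1.2, q.2.2⟩)
  invFun a := ⟨⟨(a.1.1, a.2.1), fun h => a.1.2 (congrArg Prod.fst h)⟩, a.1.2, a.2.2⟩
  left_inv q := rfl
  right_inv a := rfl
  continuous_toFun := by fun_prop
  continuous_invFun := by fun_prop

/-- `U ≅ (S ∖ n) × S`. [folklore] -/
def pieceUHomeomorph : ↥(pieceU k) ≃ₜ ↥(({northPole k}ᶜ : Set (𝕊 k))) × (𝕊 k) where
  toFun q := (⟨q.1.1.1, q.2⟩, q.1.1.2)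
  invFun a := ⟨⟨(a.1.1, a.2), fun h => a.1.2 (congrArg Prod.fst h)⟩, a.1.2⟩
  left_inv q := rfl
  right_inv a := rfl
  continuous_toFun := by fun_prop
  continuous_invFun := by fun_prop

/-- `V ≅ (S ∖ n) × S` (second coordinate first). [folklore] -/
def pieceVHomeomorph : ↥(pieceV k) ≃ₜ ↥(({northPole k}ᶜ : Set (𝕊 k))) × (𝕊 k) where
  toFun q := (⟨q.1.1.2, q.2⟩, q.1.1.1)
  invFun a := ⟨⟨(a.2, a.1.1), fun h => a.1.2 (congrArg Prod.snd h)⟩, a.1.2⟩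
  left_inv q := rfl
  right_inv a := rfl
  continuous_toFun := by fun_prop
  continuous_invFun := by fun_prop

/-- `U ∩ V` is contractible. [folklore] -/
theorem contractibleSpace_inter : ContractibleSpace ↥(pieceU k ∩ pieceV k) :=
  haveI := contractibleSpace_compl_singleton (northPole k)
  (interHomeomorph (k := k)).contractibleSpace

/-- `Hⱼ(U ∩ V; ℤ) = 0` for `j ≠ 0`. [cite: HatcherAT2002, Prop. 2.8] -/
theorem isZero_singularHomology_inter {j : ℕ} (hj : j ≠ 0) :
    IsZero (singularHomology ℤ ℤ ↥(pieceU k ∩ pieceV k) j) :=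
  haveI := contractibleSpace_inter (k := k)
  isZero_singularHomology_of_contractibleSpace ℤ ℤ hj

/-- The slice `S → U`, `x ↦ (s, x)` (through `(S ∖ n) × S`). [folklore] -/
def sliceU (k : ℕ) : C(𝕊 k, ↥(pieceU k)) :=
  ((pieceUHomeomorph (k := k)).symm :
      C(↥(({northPole k}ᶜ : Set (𝕊 k))) × (𝕊 k), ↥(pieceU k))).comp
    (sliceMap (⟨southPole k, southPole_ne_northPole⟩ : ↥(({northPole k}ᶜ : Set (𝕊 k)))))

/-- The slice `S → V`, `x ↦ (x, s)`. [folklore] -/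
def sliceV (k : ℕ) : C(𝕊 k, ↥(pieceV k)) :=
  ((pieceVHomeomorph (k := k)).symm :
      C(↥(({northPole k}ᶜ : Set (𝕊 k))) × (𝕊 k), ↥(pieceV k))).comp
    (sliceMap (⟨southPole k, southPole_ne_northPole⟩ : ↥(({northPole k}ᶜ : Set (𝕊 k)))))

/-- The slices are homology isomorphisms. [cite: HatcherAT2002, Cor. 2.11] -/
theorem isIso_map_sliceU (j : ℕ) : IsIso (singularHomology.map ℤ ℤ (sliceU k) j) := by
  haveI := contractibleSpace_compl_singleton (northPole k)
  haveI := isIso_map_sliceMap (Y := 𝕊 k)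
    (⟨southPole k, southPole_ne_northPole⟩ : ↥(({northPole k}ᶜ : Set (𝕊 k)))) j
  rw [sliceU, singularHomology.map_comp, ← singularHomology.mapIso_hom]
  infer_instance

/-- The slice `S → V` is a homology isomorphism. [cite: HatcherAT2002, Cor. 2.11] -/
theorem isIso_map_sliceV (j : ℕ) : IsIso (singularHomology.map ℤ ℤ (sliceV k) j) := by
  haveI := contractibleSpace_compl_singleton (northPole k)
  haveI := isIso_map_sliceMap (Y := 𝕊 k)
    (⟨southPole k, southPole_ne_northPole⟩ : ↥(({northPole k}ᶜ : Set (𝕊 k)))) j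
  rw [sliceV, singularHomology.map_comp, ← singularHomology.mapIso_hom]
  infer_instance

/-- `Hⱼ(U; ℤ) = 0` for `j ≠ 0, k` (`U ≃ Sᵏ`). [cite: HatcherAT2002, Cor. 2.11 and Cor. 2.14] -/
theorem isZero_singularHomology_pieceU {j : ℕ} (hj : j ≠ 0) (hjk : j ≠ k) :
    IsZero (singularHomology ℤ ℤ ↥(pieceU k) j) :=
  haveI := isIso_map_sliceU (k := k) j
  (isZero_singularHomology_sphere hj hjk).of_iso (asIso (singularHomology.map ℤ ℤ (sliceU k) j)).symm

/-- `Hⱼ(V; ℤ) = 0` for `j ≠ 0, k` (`V ≃ Sᵏ`). [cite: HatcherAT2002, Cor. 2.11 and Cor. 2.14] -/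
theorem isZero_singularHomology_pieceV {j : ℕ} (hj : j ≠ 0) (hjk : j ≠ k) :
    IsZero (singularHomology ℤ ℤ ↥(pieceV k) j) :=
  haveI := isIso_map_sliceV (k := k) j
  (isZero_singularHomology_sphere hj hjk).of_iso (asIso (singularHomology.map ℤ ℤ (sliceV k) j)).symm

/-! ### Mayer–Vietoris for `X' = U ∪ V` -/

/-- **`Hₖ(U) ⊕ Hₖ(V) → Hₖ(X')` is onto** (`k ≥ 2`): the next term of the Mayer–Vietoris sequence
is `Hₖ₋₁(U ∩ V) = 0`. [cite: HatcherAT2002, §2.2 pp. 149–150] -/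
theorem epi_ψ (hk : 2 ≤ k) : Epi (mayerVietoris.ψ ℤ ℤ (pieceU k) (pieceV k) k) := by
  obtain ⟨m, rfl⟩ : ∃ m, k = m + 1 := ⟨k - 1, by omega⟩
  have hex := mayerVietoris.exact₂_holds ℤ ℤ (pieceU (m + 1)) (pieceV (m + 1))
    (relativeSingularHomology.isIso_map_of_interior_union_interior_holds ℤ ℤ _)
    interior_pieceU_union m
  refine hex.epi_f ?_
  exact (isZero_singularHomology_inter (k := m + 1) (by omega)).eq_of_tgt _ _

/-- **`Hₖ₋₁(X'; ℤ) = 0` for `k ≥ 3`**: its neighbours `Hₖ₋₁(U) ⊕ Hₖ₋₁(V)` and `Hₖ₋₂(U ∩ V)` in the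
Mayer–Vietoris sequence vanish. [cite: HatcherAT2002, §2.2 pp. 149–150] -/
theorem isZero_singularHomology_punct_pred (hk : 3 ≤ k) :
    IsZero (singularHomology ℤ ℤ ↥(punctSet k) (k - 1)) := by
  obtain ⟨m, rfl⟩ : ∃ m, k = m + 2 := ⟨k - 2, by omega⟩
  have hex := mayerVietoris.exact₂_holds ℤ ℤ (pieceU (m + 2)) (pieceV (m + 2))
    (relativeSingularHomology.isIso_map_of_interior_union_interior_holds ℤ ℤ _)
    interior_pieceU_union m
  have h1 : IsZero (singularHomology ℤ ℤ ↥(pieceU (m + 2)) (m + 1) ⊞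
      singularHomology ℤ ℤ ↥(pieceV (m + 2)) (m + 1)) :=
    (biprod_isZero_iff _ _).2 ⟨isZero_singularHomology_pieceU (by omega) (by omega),
      isZero_singularHomology_pieceV (by omega) (by omega)⟩
  have h3 : IsZero (singularHomology ℤ ℤ ↥(pieceU (m + 2) ∩ pieceV (m + 2)) m) :=
    isZero_singularHomology_inter (by omega)
  exact hex.isZero_of_both_zeros (h1.eq_of_src _ _) (h3.eq_of_tgt _ _)

/-! ### From `X'` to `X`: the pair `(X, X')` has the local homology of `X` at the puncture -/

/-- The inclusion `X' ↪ X`. [folklore] -/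
abbrev punctIncl (k : ℕ) : C(↥(punctSet k), (𝕊 k) × (𝕊 k)) := ⟨Subtype.val, continuous_subtype_val⟩

/-- **`Hⱼ(X, X'; ℤ) = Hⱼ(X | P; ℤ) = 0` for `j ≠ 2k`** (local homology of the `2k`-manifold `X`).
[cite: HatcherAT2002, §3.3 p. 231] -/
theorem isZero_relativeSingularHomology_punct {j : ℕ} (hj : j ≠ k + k) :
    IsZero (relativeSingularHomology ℤ ℤ ((𝕊 k) × (𝕊 k)) (punctSet k) j) := by
  letI := chartedSpace k
  exact isZero_localHomology_of_ne ℤ ℤ (puncture k) hj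

/-- **`Hₖ(X'; ℤ) → Hₖ(X; ℤ)` is onto** (`k ≥ 1`): the next term of the sequence of the pair is
`Hₖ(X, X') = 0`. [cite: HatcherAT2002, Thm. 2.13 ff. and §3.3 p. 231] -/
theorem epi_map_punctIncl (hk : 1 ≤ k) : Epi (singularHomology.map ℤ ℤ (punctIncl k) k) :=
  (relativeSingularHomology.exact_map_ofAbsolute ℤ ℤ (punctSet k) k).epi_f
    ((isZero_relativeSingularHomology_punct (by omega)).eq_of_tgt _ _)

/-- **`Hₖ₋₁(Sᵏ × Sᵏ; ℤ) = 0`** (`k ≥ 2`): for `k ≥ 3` from `Hₖ₋₁(X') = 0` and `Hₖ₋₁(X, X') = 0`;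
for `k = 2`, `H₁ = 0` since `S² × S²` is simply connected (Hurewicz in degree one).
[cite: HatcherAT2002, Example 3.11; §2.2 pp. 149–150; §2.A Thm. 2A.1] -/
theorem isZero_singularHomology_pred (hk : 2 ≤ k) :
    IsZero (singularHomology ℤ ℤ ((𝕊 k) × (𝕊 k)) (k - 1)) := by
  rcases Nat.lt_or_ge k 3 with h | h
  · obtain rfl : k = 2 := by omega
    haveI := simplyConnectedSpace (k := 2) le_rfl
    exact isZero_singularHomology_one_of_simplyConnectedSpace ℤ ℤ
  · have hex := relativeSingularHomology.exact_map_ofAbsolute ℤ ℤ (punctSet k) (k - 1)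
    exact hex.isZero_of_both_zeros ((isZero_singularHomology_punct_pred h).eq_of_src _ _)
      ((isZero_relativeSingularHomology_punct (by omega)).eq_of_tgt _ _)

/-! ### `Hₖ(Sᵏ × Sᵏ; ℤ)` is generated by the two factors -/

/-- `[Sᵏ]` generates `Hₖ(Sᵏ; ℤ)`: every class is an integer multiple of the fundamental class
(Hatcher Thm. 3.26(a): `Hₖ(Sᵏ) → Hₖ(Sᵏ | x) ≅ ℤ` is an isomorphism taking `[Sᵏ]` to a generator).
[cite: HatcherAT2002, Thm. 3.26(a)] -/
theorem exists_eq_smul_fundamentalClass_sphere (hk : 2 ≤ k) (z : ↥(singularHomology ℤ ℤ (𝕊 k) k)) :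
    ∃ c : ℤ, z = c • (μS hk).fundamentalClass := by
  haveI : ConnectedSpace (𝕊 k) := by
    haveI := simplyConnectedSpace_sphere hk
    infer_instance
  let x : 𝕊 k := southPole k
  obtain ⟨e, he⟩ := (μS hk).isGenerator x
  have hfc := HomologicalOrientation.isFundamentalClass_fundamentalClass_holds (R := ℤ) (X := 𝕊 k)
    k (μS hk)
  haveI := singularHomology.isIso_toLocal_of_orientation (μS hk) x
  refine ⟨e (singularHomology.toLocal ℤ ℤ x k z), ?_⟩
  apply ((ConcreteCategory.isIso_iff_bijective (singularHomology.toLocal ℤ ℤ x k)).1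
    inferInstance).1
  rw [map_zsmul]
  change _ = _ • singularHomology.toLocal ℤ ℤ x k (μS hk).fundamentalClass
  rw [hfc x]
  apply e.injective
  rw [map_zsmul, he, zsmul_eq_mul, mul_one, Int.cast_id]

/-- `punctIncl ∘ (U ↪ X') ∘ sliceU = ι₂`. [folklore] -/
theorem punctIncl_comp_sliceU :
    ((punctIncl k).comp (subsetIncl (pieceU k))).comp (sliceU k) = ι₂ k := by
  ext x <;> rfl

/-- `punctIncl ∘ (V ↪ X') ∘ sliceV = ι₁`. [folklore] -/
theorem punctIncl_comp_sliceV :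
    ((punctIncl k).comp (subsetIncl (pieceV k))).comp (sliceV k) = ι₁ k := by
  ext x <;> rfl

/-- On homology: `incl_* (j_U)_* (sliceU)_* = (ι₂)_*`. [folklore] -/
theorem map_punctIncl_map_sliceU (x : ↥(singularHomology ℤ ℤ (𝕊 k) k)) :
    singularHomology.map ℤ ℤ (punctIncl k) k (singularHomology.map ℤ ℤ (subsetIncl (pieceU k)) k
      (singularHomology.map ℤ ℤ (sliceU k) k x)) = singularHomology.map ℤ ℤ (ι₂ k) k x := by
  rw [← ModuleCat.comp_apply, ← ModuleCat.comp_apply, ← singularHomology.map_comp,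
    ← singularHomology.map_comp, punctIncl_comp_sliceU]

/-- On homology: `incl_* (j_V)_* (sliceV)_* = (ι₁)_*`. [folklore] -/
theorem map_punctIncl_map_sliceV (x : ↥(singularHomology ℤ ℤ (𝕊 k) k)) :
    singularHomology.map ℤ ℤ (punctIncl k) k (singularHomology.map ℤ ℤ (subsetIncl (pieceV k)) k
      (singularHomology.map ℤ ℤ (sliceV k) k x)) = singularHomology.map ℤ ℤ (ι₁ k) k x := by
  rw [← ModuleCat.comp_apply, ← ModuleCat.comp_apply, ← singularHomology.map_comp,
    ← singularHomology.map_comp, punctIncl_comp_sliceV]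

/-- **`Hₖ(Sᵏ × Sᵏ; ℤ)` is generated by the classes of the two factors**: every class is
`c₀ ι₁₊[S] + c₁ ι₂₊[S]` (Hatcher Example 3.11: `Hₖ(Sᵏ × Sᵏ) = ℤ²` on the two factors; here from
Mayer–Vietoris for `X ∖ (n, n)` and the pair `(X, X ∖ (n, n))`). [cite: HatcherAT2002, Example 3.11 and §2.2 pp. 149–150] -/
theorem exists_eq_sum_smul_y (hk : 2 ≤ k) (z : ↥(singularHomology ℤ ℤ ((𝕊 k) × (𝕊 k)) k)) :
    ∃ c : Fin 2 → ℤ, z = c 0 • y hk 0 + c 1 • y hk 1 := by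
  -- lift to the punctured product
  obtain ⟨z', rfl⟩ := (ModuleCat.epi_iff_surjective _).1 (epi_map_punctIncl (k := k) (by omega)) z
  -- decompose by Mayer–Vietoris
  obtain ⟨w, rfl⟩ := (ModuleCat.epi_iff_surjective _).1 (epi_ψ hk) z'
  set u := (biprod.fst : singularHomology ℤ ℤ ↥(pieceU k) k ⊞ singularHomology ℤ ℤ ↥(pieceV k) k ⟶ _) w
  set v := (biprod.snd : singularHomology ℤ ℤ ↥(pieceU k) k ⊞ singularHomology ℤ ℤ ↥(pieceV k) k ⟶ _) w
  have hw : mayerVietoris.ψ ℤ ℤ (pieceU k) (pieceV k) k w =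
      singularHomology.map ℤ ℤ (subsetIncl (pieceU k)) k u +
        singularHomology.map ℤ ℤ (subsetIncl (pieceV k)) k v :=
    biprod_desc_apply _ _ w
  -- the pieces come from the slices
  obtain ⟨u', hu'⟩ := ((ConcreteCategory.isIso_iff_bijective _).1 (isIso_map_sliceU (k := k) k)).2 u
  obtain ⟨v', hv'⟩ := ((ConcreteCategory.isIso_iff_bijective _).1 (isIso_map_sliceV (k := k) k)).2 v
  obtain ⟨cu, rfl⟩ := exists_eq_smul_fundamentalClass_sphere hk u'
  obtain ⟨cv, rfl⟩ := exists_eq_smul_fundamentalClass_sphere hk v'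
  refine ⟨![cv, cu], ?_⟩
  rw [hw, ← hu', ← hv', map_add, map_zsmul, map_zsmul, map_zsmul, map_zsmul, map_zsmul, map_zsmul,
    map_punctIncl_map_sliceU, map_punctIncl_map_sliceV]
  simp only [y, ι_zero, ι_one, Matrix.cons_val_zero, Matrix.cons_val_one]
  exact add_comm _ _

/-! ### `Hᵏ(Sᵏ × Sᵏ; ℤ)` is detected by the two factors; `ḡ₁, ḡ₂` is a basis of `Hᵏ/T` -/

/-- **The Kronecker map `Hᵏ(Sᵏ × Sᵏ; ℤ) → Hom(Hₖ, ℤ)` is injective** (universal coefficients with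
`Hₖ₋₁ = 0`, Hatcher Thm. 3.2). [cite: HatcherAT2002, Thm. 3.2] -/
theorem injective_kroneckerPairing (hk : 2 ≤ k) :
    Function.Injective (kroneckerPairing ℤ ℤ ((𝕊 k) × (𝕊 k)) k) := by
  obtain ⟨m, rfl⟩ : ∃ m, k = m + 1 := ⟨k - 1, by omega⟩
  exact (kroneckerPairing_bijective_of_isZero ℤ ((𝕊 (m + 1)) × (𝕊 (m + 1))) m
    (by simpa using isZero_singularHomology_pred (k := m + 1) hk)).1

/-- **Evaluation on the two factors**: `a ↦ (⟨a, ι₁₊[S]⟩, ⟨a, ι₂₊[S]⟩) : Hᵏ(Sᵏ × Sᵏ; ℤ) → ℤ²`.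
[folklore] -/
def evalH (hk : 2 ≤ k) : ↥(singularCohomology ℤ ℤ ((𝕊 k) × (𝕊 k)) k) →ₗ[ℤ] (Fin 2 → ℤ) :=
  LinearMap.pi fun b => (kroneckerPairing ℤ ℤ ((𝕊 k) × (𝕊 k)) k).flip (y hk b)

/-- `evalH a b = ⟨a, y_b⟩`. [folklore] -/
@[simp] theorem evalH_apply (hk : 2 ≤ k) (a : ↥(singularCohomology ℤ ℤ ((𝕊 k) × (𝕊 k)) k))
    (b : Fin 2) : evalH hk a b = kroneckerPairing ℤ ℤ ((𝕊 k) × (𝕊 k)) k a (y hk b) := rfl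

/-- **A class in `Hᵏ(Sᵏ × Sᵏ; ℤ)` is determined by its values on the two factors** (Hatcher
Example 3.11 with Thm. 3.2: `Hᵏ ≅ Hom(Hₖ, ℤ)` and `Hₖ` is generated by the factors).
[cite: HatcherAT2002, Example 3.11 and Thm. 3.2] -/
theorem injective_evalH (hk : 2 ≤ k) : Function.Injective (evalH hk) := by
  rw [injective_iff_map_eq_zero]
  intro a ha
  apply injective_kroneckerPairing hk
  rw [map_zero]
  refine LinearMap.ext fun z => ?_
  obtain ⟨c, rfl⟩ := exists_eq_sum_smul_y hk z
  have h0 : kroneckerPairing ℤ ℤ ((𝕊 k) × (𝕊 k)) k a (y hk 0) = 0 := by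
    simpa using congrFun ha 0
  have h1 : kroneckerPairing ℤ ℤ ((𝕊 k) × (𝕊 k)) k a (y hk 1) = 0 := by
    simpa using congrFun ha 1
  rw [map_add, map_zsmul, map_zsmul, h0, h1, smul_zero, smul_zero, add_zero, LinearMap.zero_apply]

/-- `Hᵏ(Sᵏ × Sᵏ; ℤ)` is finitely generated (it embeds in `ℤ²`). [cite: HatcherAT2002, Example 3.11] -/
theorem finite_singularCohomology (hk : 2 ≤ k) :
    Module.Finite ℤ ↥(singularCohomology ℤ ℤ ((𝕊 k) × (𝕊 k)) k) :=
  Module.Finite.of_injective (evalH hk) (injective_evalH hk)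

/-- Evaluation on a homology class descends to `Hᵏ/T` (torsion classes pair to zero).
[cite: HatcherAT2002, §3.3 p. 250] -/
def evalL (hk : 2 ≤ k) (b : Fin 2) : ↥(freeCohomology ℤ ((𝕊 k) × (𝕊 k)) k) →ₗ[ℤ] ℤ :=
  (Submodule.torsion ℤ ↥(singularCohomology ℤ ℤ ((𝕊 k) × (𝕊 k)) k)).liftQ
    ((kroneckerPairing ℤ ℤ ((𝕊 k) × (𝕊 k)) k).flip (y hk b)) fun a ha => by
      rw [LinearMap.mem_ker, LinearMap.flip_apply]
      exact bilinear_apply_eq_zero_of_mem_torsion _ ha _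

/-- `evalL b [a] = ⟨a, y_b⟩`. [folklore] -/
@[simp] theorem evalL_mk (hk : 2 ≤ k) (b : Fin 2) (a : ↥(singularCohomology ℤ ℤ ((𝕊 k) × (𝕊 k)) k)) :
    evalL hk b (freeCohomology.mk a) = kroneckerPairing ℤ ℤ ((𝕊 k) × (𝕊 k)) k a (y hk b) :=
  rfl

/-- **`rank Hᵏ(Sᵏ × Sᵏ; ℤ)/T ≤ 2`** (it embeds in `ℤ²` by evaluation on the factors). [cite: HatcherAT2002, Example 3.11] -/
theorem finrank_freeCohomology_le (hk : 2 ≤ k) :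
    Module.finrank ℤ ↥(freeCohomology ℤ ((𝕊 k) × (𝕊 k)) k) ≤ 2 := by
  let F : ↥(freeCohomology ℤ ((𝕊 k) × (𝕊 k)) k) →ₗ[ℤ] (Fin 2 → ℤ) := LinearMap.pi (evalL hk)
  have hF : Function.Injective F := by
    rw [injective_iff_map_eq_zero]
    intro x hx
    induction x using freeCohomology.induction_on with
    | h a =>
      have ha : evalH hk a = 0 := by
        funext b
        exact congrFun hx b
      rw [(injective_iff_map_eq_zero _).1 (injective_evalH hk) a ha, map_zero]
  simpa using LinearMap.finrank_le_finrank_of_injective hF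

/-- **`ḡ₁, ḡ₂` is a basis of `Hᵏ(Sᵏ × Sᵏ; ℤ)/T`** (Hatcher Example 3.11: `Hᵏ(Sᵏ × Sᵏ) = ℤα ⊕ ℤβ`):
the classes `gₐ` are detected by the factors with the identity matrix `⟨gₐ, ι_b₊[S]⟩ = δ_{ab}`,
and `rank Hᵏ/T ≤ 2` (`exists_basis_of_isUnit_eval`). [cite: HatcherAT2002, Example 3.11] -/
theorem exists_basis_freeCohomology (hk : 2 ≤ k) :
    ∃ b : Module.Basis (Fin 2) ℤ ↥(freeCohomology ℤ ((𝕊 k) × (𝕊 k)) k),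
      ∀ a, b a = freeCohomology.mk (g hk a) := by
  haveI := finite_singularCohomology hk
  obtain ⟨hF1, hF2⟩ := finite_free_freeCohomology_of_finite (R := ℤ) (Y := (𝕊 k) × (𝕊 k)) k
  haveI := hF1
  haveI := hF2
  refine exists_basis_of_isUnit_eval (finrank_freeCohomology_le hk) (evalL hk)
    (fun a => freeCohomology.mk (g hk a)) ?_
  have hM : (Matrix.of fun i j => evalL hk j (freeCohomology.mk (g hk i))) = 1 := by
    ext i j
    rw [Matrix.of_apply, evalL_mk, kroneckerPairing_g_y, Matrix.one_apply]
  rw [hM]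
  exact isUnit_one

/-- `rank Hᵏ(Sᵏ × Sᵏ; ℤ)/T = 2`. [cite: HatcherAT2002, Example 3.11] -/
theorem finrank_freeCohomology (hk : 2 ≤ k) :
    Module.finrank ℤ ↥(freeCohomology ℤ ((𝕊 k) × (𝕊 k)) k) = 2 := by
  obtain ⟨b, -⟩ := exists_basis_freeCohomology hk
  simpa using Module.finrank_eq_card_basis b

/-! ### `⟨g₁ ⌣ g₂, [Sᵏ × Sᵏ]⟩ = ±1` by Poincaré duality -/

/-- **The cup product of the two generators evaluates to `±1` on the fundamental class**, for
every `ℤ`-orientation `μ` of `Sᵏ × Sᵏ` (`k ≥ 2`): Hatcher Example 3.11 / Thm. 3.15 (`αβ`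
generates `H²ᵏ(Sᵏ × Sᵏ)`), obtained here from Poincaré duality — the cup-product form on
`Hᵏ/T = ℤḡ₁ ⊕ ℤḡ₂` is unimodular (Cor. 3.39, `isPerfPair_cupPairingModTorsion_holds`) and its
Gram matrix is `(0, x; ±x, 0)` with `x = ⟨g₁ ⌣ g₂, [X]⟩` (`gₐ ⌣ gₐ = 0`, graded commutativity), so
`det = ∓x²` is a unit of `ℤ` and `x = ±1`. [cite: HatcherAT2002, Example 3.11 and Cor. 3.39] -/
theorem abs_cupPairing_g (hk : 2 ≤ k) (μ : HomologicalOrientation ℤ ((𝕊 k) × (𝕊 k)) (k + k)) :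
    |cupPairing μ rfl (g hk 0) (g hk 1)| = 1 := by
  letI := chartedSpace k
  obtain ⟨b, hb⟩ := exists_basis_freeCohomology hk
  -- the cup-product form mod torsion is unimodular (Poincaré duality)
  have hP : (intersectionForm (rfl : k + k = k + k) μ).IsUnimodular :=
    isPerfPair_cupPairingModTorsion_holds (μ := μ) (h := (rfl : k + k = k + k))
  have hdet := ((intersectionForm (rfl : k + k = k + k) μ).isUnimodular_iff_isUnit_det_holds b).1 hP
  -- its Gram matrix in the basis `ḡ₁, ḡ₂`
  set x : ℤ := cupPairing μ rfl (g hk 0) (g hk 1) with hx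
  have h00 : LinearMap.BilinForm.toMatrix b (intersectionForm rfl μ) 0 0 = 0 := by
    rw [LinearMap.BilinForm.toMatrix_apply, hb, intersectionForm_mk_mk, cupPairing_apply,
      cupProduct_g_self hk 0, map_zero, LinearMap.zero_apply]
  have h11 : LinearMap.BilinForm.toMatrix b (intersectionForm rfl μ) 1 1 = 0 := by
    rw [LinearMap.BilinForm.toMatrix_apply, hb, intersectionForm_mk_mk, cupPairing_apply,
      cupProduct_g_self hk 1, map_zero, LinearMap.zero_apply]
  have h01 : LinearMap.BilinForm.toMatrix b (intersectionForm rfl μ) 0 1 = x := by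
    rw [LinearMap.BilinForm.toMatrix_apply, hb, hb, intersectionForm_mk_mk]
  have h10 : LinearMap.BilinForm.toMatrix b (intersectionForm rfl μ) 1 0 = (-1 : ℤ) ^ (k * k) * x := by
    rw [LinearMap.BilinForm.toMatrix_apply, hb, hb, intersectionForm_mk_mk, cupPairing_apply,
      cupProduct_gradedComm_holds ℤ _ rfl rfl (g hk 1) (g hk 0),
      (kroneckerPairing ℤ ℤ ((𝕊 k) × (𝕊 k)) (k + k)).map_smul, LinearMap.smul_apply, smul_eq_mul,
      hx, cupPairing_apply]
  rw [Matrix.det_fin_two, h00, h11, h01, h10, zero_mul, zero_sub] at hdet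
  -- `IsUnit (-(x * ((-1)^(k*k) * x)))` forces `x = ±1`
  have hxu : IsUnit x := isUnit_of_mul_isUnit_left ((IsUnit.neg_iff _).1 hdet)
  rcases Int.isUnit_iff.1 hxu with h | h <;> rw [h] <;> norm_num

/-- Symmetric form: `|⟨g₂ ⌣ g₁, [Sᵏ × Sᵏ]⟩| = 1`. [cite: HatcherAT2002, Example 3.11 and Cor. 3.39] -/
theorem abs_cupPairing_g' (hk : 2 ≤ k) (μ : HomologicalOrientation ℤ ((𝕊 k) × (𝕊 k)) (k + k)) :
    |cupPairing μ rfl (g hk 1) (g hk 0)| = 1 := by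
  rw [cupPairing_apply, cupProduct_gradedComm_holds ℤ _ rfl rfl (g hk 1) (g hk 0),
    (kroneckerPairing ℤ ℤ ((𝕊 k) × (𝕊 k)) (k + k)).map_smul, LinearMap.smul_apply, smul_eq_mul,
    abs_mul, abs_pow, abs_neg, abs_one, one_pow, one_mul, ← cupPairing_apply]
  exact abs_cupPairing_g hk μ

/-- **`⟨gₐ ⌣ gₐ, [Sᵏ × Sᵏ]⟩ = 0`.** [cite: HatcherAT2002, Example 3.11] -/
theorem cupPairing_g_self (hk : 2 ≤ k) (μ : HomologicalOrientation ℤ ((𝕊 k) × (𝕊 k)) (k + k))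
    (a : Fin 2) : cupPairing μ rfl (g hk a) (g hk a) = 0 := by
  rw [cupPairing_apply, cupProduct_g_self hk a, map_zero, LinearMap.zero_apply]

/-! ## The antipodal map, and the vanishing of `g₁ + g₂` off the diagonal -/

/-! ### The antipodal map of `Sᵏ` acts by `-1` on `Hₖ(Sᵏ; ℤ)` for `k` even -/

/-- The antipodal map `x ↦ -x` of `Sᵏ`. [folklore] -/
def antipode (k : ℕ) : C(𝕊 k, 𝕊 k) := ⟨fun x => -x, by fun_prop⟩

/-- The negation of `ℝᵏ⁺¹` as a continuous linear map. [folklore] -/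
def negCLM (k : ℕ) : 𝔼 (k + 1) →L[ℝ] 𝔼 (k + 1) := -ContinuousLinearMap.id ℝ (𝔼 (k + 1))

/-- `det(-1) = (-1)ᵏ⁺¹ < 0` on `ℝᵏ⁺¹` for `k` even. [folklore] -/
theorem det_negCLM_neg (hk : Even k) :
    LinearMap.det (negCLM k : 𝔼 (k + 1) →ₗ[ℝ] 𝔼 (k + 1)) < 0 := by
  have h : (negCLM k : 𝔼 (k + 1) →ₗ[ℝ] 𝔼 (k + 1)) = -LinearMap.id := by
    ext v i; rfl
  rw [h, show (-LinearMap.id : 𝔼 (k + 1) →ₗ[ℝ] 𝔼 (k + 1)) = (-1 : ℝ) • LinearMap.id from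
    (neg_one_smul ℝ _).symm, LinearMap.det_smul, LinearMap.det_id, mul_one,
    finrank_euclideanSpace_fin, Odd.neg_one_pow (hk.add_one)]
  norm_num

/-- The negation preserves the pair `(ℝᵏ⁺¹, ℝᵏ⁺¹ ∖ 0)`. [folklore] -/
theorem mapsTo_negCLM : Set.MapsTo (negCLM k : C(𝔼 (k + 1), 𝔼 (k + 1)))
    ({(0 : 𝔼 (k + 1))}ᶜ) ({(0 : 𝔼 (k + 1))}ᶜ) := by
  intro v hv
  simpa [negCLM] using hv

/-- The negation of `ℝᵏ⁺¹ ∖ 0`. [folklore] -/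
def negPunct (k : ℕ) : C(↥(({(0 : 𝔼 (k + 1))}ᶜ : Set (𝔼 (k + 1)))), ↥(({(0 : 𝔼 (k + 1))}ᶜ : Set (𝔼 (k + 1))))) :=
  subsetRestrict (negCLM k : C(𝔼 (k + 1), 𝔼 (k + 1))) mapsTo_negCLM

/-- `sphereToComplZero ∘ antipode = negPunct ∘ sphereToComplZero`. [folklore] -/
theorem sphereToComplZero_comp_antipode :
    (sphereToComplZero k).comp (antipode k) = (negPunct k).comp (sphereToComplZero k) := by
  ext x : 1
  rfl

/-- **The antipodal map of an even-dimensional sphere acts by `-1` on `Hₖ(Sᵏ; ℤ)`** (`k ≥ 2`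
even): `-1 ∈ GL(k+1, ℝ)` has negative determinant, so it acts by `-1` on
`Hₖ₊₁(ℝᵏ⁺¹ | 0; ℤ)` (Hatcher §2.2 Exercise 7 / property (e); tree theorem
`localHomology_map_continuousLinearMap_of_det_neg`), hence on `Hₖ(ℝᵏ⁺¹ ∖ 0)` (naturality of the
connecting isomorphism, `ℝᵏ⁺¹` contractible) and on `Hₖ(Sᵏ)` (`Sᵏ ↪ ℝᵏ⁺¹ ∖ 0` is a homotopy
equivalence). [cite: HatcherAT2002, §2.2 property (g) p. 134 (deg of the antipodal map is (-1)ⁿ⁺¹) and Exercise 7 p. 155] -/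
theorem map_antipode (hk : 2 ≤ k) (hke : Even k) :
    singularHomology.map ℤ ℤ (antipode k) k = -𝟙 _ := by
  obtain ⟨m, rfl⟩ : ∃ m, k = m + 1 := ⟨k - 1, by omega⟩
  -- the three maps: on the pair, on the punctured space, on the sphere
  have hpair := localHomology_map_continuousLinearMap_of_det_neg (negCLM (m + 1))
    (det_negCLM_neg hke)
  -- `∂ : H_{m+2}(E, E ∖ 0) → H_{m+1}(E ∖ 0)` is natural and an isomorphism
  have hnat := relativeSingularHomology.δ_naturality ℤ ℤ
    (negCLM (m + 1) : C(𝔼 (m + 1 + 1), 𝔼 (m + 1 + 1))) mapsTo_negCLM (m + 1)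
  have hE0 : ∀ j, j ≠ 0 → IsZero (singularHomology ℤ ℤ (𝔼 (m + 1 + 1)) j) := fun j hj =>
    isZero_singularHomology_of_contractibleSpace ℤ ℤ hj
  haveI hδ : IsIso (relativeSingularHomology.δ ℤ ℤ (𝔼 (m + 1 + 1))
      ({(0 : 𝔼 (m + 1 + 1))}ᶜ) (m + 1)) := by
    have hmono : Mono (relativeSingularHomology.δ ℤ ℤ (𝔼 (m + 1 + 1))
        ({(0 : 𝔼 (m + 1 + 1))}ᶜ) (m + 1)) :=
      (relativeSingularHomology.exact_ofAbsolute_δ ℤ ℤ _ (m + 1)).mono_g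
        ((hE0 _ (by omega)).eq_of_src _ _)
    have hepi : Epi (relativeSingularHomology.δ ℤ ℤ (𝔼 (m + 1 + 1))
        ({(0 : 𝔼 (m + 1 + 1))}ᶜ) (m + 1)) :=
      (relativeSingularHomology.exact_δ_map ℤ ℤ _ (m + 1)).epi_f
        ((hE0 _ (by omega)).eq_of_tgt _ _)
    exact isIso_of_mono_of_epi _
  -- so the negation acts by `-1` on `H_{m+1}(E ∖ 0)`
  have hpunct : singularHomology.map ℤ ℤ (negPunct (m + 1)) (m + 1) = -𝟙 _ := by
    have e : relativeSingularHomology.δ ℤ ℤ (𝔼 (m + 1 + 1)) ({(0 : 𝔼 (m + 1 + 1))}ᶜ) (m + 1) ≫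
        singularHomology.map ℤ ℤ (negPunct (m + 1)) (m + 1) =
        relativeSingularHomology.δ ℤ ℤ (𝔼 (m + 1 + 1)) ({(0 : 𝔼 (m + 1 + 1))}ᶜ) (m + 1) ≫
          (-𝟙 _) := by
      rw [Preadditive.comp_neg, Category.comp_id]
      change relativeSingularHomology.δ ℤ ℤ _ _ (m + 1) ≫ singularHomology.map ℤ ℤ
        (subsetRestrict (negCLM (m + 1) : C(𝔼 (m + 1 + 1), 𝔼 (m + 1 + 1))) mapsTo_negCLM) (m + 1) = _
      rw [hnat, hpair, Preadditive.neg_comp, Category.id_comp]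
    exact (cancel_epi _).1 e
  -- and on `H_{m+1}(S^{m+1})` through the homotopy equivalence `S ↪ E ∖ 0`
  haveI := isIso_singularHomology_map_sphereToComplZero ℤ ℤ (m + 1) (m + 1)
  have e2 : singularHomology.map ℤ ℤ (antipode (m + 1)) (m + 1) ≫
      singularHomology.map ℤ ℤ (sphereToComplZero (m + 1)) (m + 1) =
      (-𝟙 _) ≫ singularHomology.map ℤ ℤ (sphereToComplZero (m + 1)) (m + 1) := by
    rw [← singularHomology.map_comp, sphereToComplZero_comp_antipode, singularHomology.map_comp,
      hpunct, Preadditive.comp_neg, Preadditive.neg_comp, Category.comp_id, Category.id_comp]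
  exact (cancel_mono _).1 e2

/-- **`antipode^* γ = -γ` in `Hᵏ(Sᵏ; ℤ)` for `k ≥ 2` even** (dual statement, by universal
coefficients: `Hᵏ(Sᵏ) ↪ Hom(Hₖ(Sᵏ), ℤ)`). [cite: HatcherAT2002, §2.2 property (g) p. 134 and Thm. 3.2] -/
theorem map_antipode_γ (hk : 2 ≤ k) (hke : Even k) :
    singularCohomology.map ℤ ℤ (antipode k) k (γ hk) = -γ hk := by
  obtain ⟨m, rfl⟩ : ∃ m, k = m + 1 := ⟨k - 1, by omega⟩
  apply (kroneckerPairing_bijective_of_isZero ℤ (𝕊 (m + 1)) m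
    (isZero_singularHomology_sphere (by omega) (by omega))).1
  refine LinearMap.ext fun z => ?_
  rw [kroneckerPairing_map, map_antipode hk hke, map_neg, LinearMap.neg_apply]
  have hz : ((-𝟙 (singularHomology ℤ ℤ (𝕊 (m + 1)) (m + 1)) : _ ⟶ _) z) = -z := rfl
  rw [hz, map_neg]

/-! ### The complement of the diagonal deformation retracts onto the antidiagonal -/

/-- The diagonal of `Sᵏ × Sᵏ`. [folklore] -/
def diagonal (k : ℕ) : Set ((𝕊 k) × (𝕊 k)) := {q | q.1 = q.2}

/-- The antidiagonal embedding `x ↦ (x, -x)` of `Sᵏ` into the complement of the diagonal.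
[cite: MilnorStasheff1974, §11 (proof of Thm. 11.1: the normal bundle of the diagonal)] -/
def antidiag (k : ℕ) : C(𝕊 k, ↥((diagonal k)ᶜ)) where
  toFun x := ⟨(x, antipode k x), fun h => by
    have h' : (x : 𝔼 (k + 1)) = -(x : 𝔼 (k + 1)) := congrArg Subtype.val h
    have hx : (x : 𝔼 (k + 1)) = 0 := by
      have : (2 : ℝ) • (x : 𝔼 (k + 1)) = 0 := by rw [two_smul]; nth_rw 2 [h']; simp
      simpa using this
    exact ne_zero_of_mem_unit_sphere x hx⟩
  continuous_toFun := by fun_prop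

/-- The first projection on the complement of the diagonal. [folklore] -/
def pr₁Compl (k : ℕ) : C(↥((diagonal k)ᶜ), 𝕊 k) := (pr₁ k).comp (subsetIncl _)

/-- `pr₁ ∘ antidiag = id`. [folklore] -/
theorem pr₁Compl_comp_antidiag : (pr₁Compl k).comp (antidiag k) = ContinuousMap.id (𝕊 k) := by
  ext x : 1; rfl

/-- On the complement of the diagonal, the segment from `y` to `-x` avoids `0`:
`(1 - t) y - t x ≠ 0` for `y ≠ x` on the unit sphere. [folklore] -/
theorem seg_ne_zero {x y : 𝕊 k} (hxy : y ≠ x) (t : unitInterval) :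
    (1 - (t : ℝ)) • (y : 𝔼 (k + 1)) - (t : ℝ) • (x : 𝔼 (k + 1)) ≠ 0 := by
  intro h
  have hx1 : ‖(x : 𝔼 (k + 1))‖ = 1 := norm_eq_of_mem_sphere x
  have hy1 : ‖(y : 𝔼 (k + 1))‖ = 1 := norm_eq_of_mem_sphere y
  have heq : (1 - (t : ℝ)) • (y : 𝔼 (k + 1)) = (t : ℝ) • (x : 𝔼 (k + 1)) := sub_eq_zero.1 h
  have ht0 : 0 ≤ (t : ℝ) := t.2.1
  have ht1 : (t : ℝ) ≤ 1 := t.2.2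
  -- taking norms: `1 - t = t`, so `t = 1/2` and `y = x`
  have hn := congrArg (fun v : 𝔼 (k + 1) => ‖v‖) heq
  simp only [norm_smul, hx1, hy1, mul_one, Real.norm_eq_abs, abs_of_nonneg ht0,
    abs_of_nonneg (sub_nonneg.2 ht1)] at hn
  have ht : (t : ℝ) = 1 / 2 := by linarith
  rw [ht] at heq
  have : (y : 𝔼 (k + 1)) = (x : 𝔼 (k + 1)) := by
    have h2 := congrArg (fun v : 𝔼 (k + 1) => (2 : ℝ) • v) heq
    simp only [smul_smul] at h2
    norm_num at h2
    exact h2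
  exact hxy (Subtype.ext this)

/-- The deformation `H_t(x, y) = (x, ((1 - t) y - t x)/‖…‖)` of the complement of the diagonal
onto the antidiagonal (at `t = 1` it is `(x, -x)`); it stays off the diagonal.
[cite: MilnorStasheff1974, §11 (proof of Thm. 11.1)] -/
def antidiagHomotopyFun (k : ℕ) (p : unitInterval × ↥((diagonal k)ᶜ)) : ↥((diagonal k)ᶜ) := by
  refine ⟨(p.2.1.1, ⟨(‖(1 - (p.1 : ℝ)) • (p.2.1.2 : 𝔼 (k + 1)) - (p.1 : ℝ) • (p.2.1.1 : 𝔼 (k + 1))‖)⁻¹ •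
      ((1 - (p.1 : ℝ)) • (p.2.1.2 : 𝔼 (k + 1)) - (p.1 : ℝ) • (p.2.1.1 : 𝔼 (k + 1))), ?_⟩), ?_⟩
  · have hne := seg_ne_zero (k := k) (x := p.2.1.1) (y := p.2.1.2)
      (fun h => p.2.2 h.symm) p.1
    simp [norm_smul, inv_mul_cancel₀ (norm_ne_zero_iff.2 hne)]
  · -- the new second coordinate is not `x`: that would put `x` on the open segment from `y` to `-x`
    intro h
    have hne := seg_ne_zero (k := k) (x := p.2.1.1) (y := p.2.1.2) (fun h => p.2.2 h.symm) p.1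
    have h' : (p.2.1.1 : 𝔼 (k + 1)) =
        (‖(1 - (p.1 : ℝ)) • (p.2.1.2 : 𝔼 (k + 1)) - (p.1 : ℝ) • (p.2.1.1 : 𝔼 (k + 1))‖)⁻¹ •
          ((1 - (p.1 : ℝ)) • (p.2.1.2 : 𝔼 (k + 1)) - (p.1 : ℝ) • (p.2.1.1 : 𝔼 (k + 1))) :=
      congrArg Subtype.val h
    set r : ℝ := ‖(1 - (p.1 : ℝ)) • (p.2.1.2 : 𝔼 (k + 1)) - (p.1 : ℝ) • (p.2.1.1 : 𝔼 (k + 1))‖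
    have hr : 0 < r := norm_pos_iff.2 hne
    -- `r x = (1 - t) y - t x`, so `(r + t) x = (1 - t) y`; norms: `r + t = 1 - t`, then `y = x`
    have h2 : (r + (p.1 : ℝ)) • (p.2.1.1 : 𝔼 (k + 1)) = (1 - (p.1 : ℝ)) • (p.2.1.2 : 𝔼 (k + 1)) := by
      have := congrArg (fun v : 𝔼 (k + 1) => r • v) h'
      simp only [smul_smul, mul_inv_cancel₀ hr.ne', one_smul] at this
      rw [add_smul, this]; abel
    have ht0 : 0 ≤ (p.1 : ℝ) := p.1.2.1
    have ht1 : (p.1 : ℝ) ≤ 1 := p.1.2.2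
    have hn := congrArg (fun v : 𝔼 (k + 1) => ‖v‖) h2
    simp only [norm_smul, norm_eq_of_mem_sphere, mul_one, Real.norm_eq_abs,
      abs_of_nonneg (sub_nonneg.2 ht1), abs_of_pos (by linarith : 0 < r + (p.1 : ℝ))] at hn
    -- so `1 - t = r + t > 0` and `y = ((r+t)/(1-t)) x = x`
    have h1t : 0 < 1 - (p.1 : ℝ) := by linarith
    have : (p.2.1.2 : 𝔼 (k + 1)) = (p.2.1.1 : 𝔼 (k + 1)) := by
      have := congrArg (fun v : 𝔼 (k + 1) => (1 - (p.1 : ℝ))⁻¹ • v) h2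
      simp only [smul_smul, inv_mul_cancel₀ h1t.ne', one_smul, hn] at this
      exact this.symm
    exact p.2.2 (Subtype.ext this).symm

/-- Continuity of the deformation. [folklore] -/
theorem continuous_antidiagHomotopyFun : Continuous (antidiagHomotopyFun k) := by
  have hseg : Continuous fun p : unitInterval × ↥((diagonal k)ᶜ) =>
      (1 - (p.1 : ℝ)) • (p.2.1.2 : 𝔼 (k + 1)) - (p.1 : ℝ) • (p.2.1.1 : 𝔼 (k + 1)) := by fun_prop
  have hne : ∀ p : unitInterval × ↥((diagonal k)ᶜ),
      (1 - (p.1 : ℝ)) • (p.2.1.2 : 𝔼 (k + 1)) - (p.1 : ℝ) • (p.2.1.1 : 𝔼 (k + 1)) ≠ 0 := fun p =>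
    seg_ne_zero (k := k) (fun h => p.2.2 h.symm) p.1
  have h2 : Continuous fun p : unitInterval × ↥((diagonal k)ᶜ) =>
      (‖(1 - (p.1 : ℝ)) • (p.2.1.2 : 𝔼 (k + 1)) - (p.1 : ℝ) • (p.2.1.1 : 𝔼 (k + 1))‖)⁻¹ •
        ((1 - (p.1 : ℝ)) • (p.2.1.2 : 𝔼 (k + 1)) - (p.1 : ℝ) • (p.2.1.1 : 𝔼 (k + 1))) :=
    ((hseg.norm).inv₀ fun p => norm_ne_zero_iff.2 (hne p)).smul hseg
  have h3 : Continuous fun p : unitInterval × ↥((diagonal k)ᶜ) => (p.2.1.1 : 𝕊 k) := by fun_prop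
  unfold antidiagHomotopyFun
  exact ((h3.prodMk (h2.subtype_mk _)).subtype_mk _)

/-- **`antidiag ∘ pr₁ ≃ id` on the complement of the diagonal**: the complement of the diagonal
deformation retracts onto the antidiagonal `{(x, -x)}` (Milnor–Stasheff §11, proof of
Thm. 11.1). [cite: MilnorStasheff1974, §11 (proof of Thm. 11.1)] -/
def antidiagHomotopy (k : ℕ) :
    ContinuousMap.Homotopy (ContinuousMap.id ↥((diagonal k)ᶜ)) ((antidiag k).comp (pr₁Compl k)) where
  toFun := antidiagHomotopyFun k
  continuous_toFun := continuous_antidiagHomotopyFun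
  map_zero_left p := by
    apply Subtype.ext
    simp only [antidiagHomotopyFun, ContinuousMap.id_apply]
    refine Prod.ext rfl (Subtype.ext ?_)
    simp [norm_eq_of_mem_sphere]
  map_one_left p := by
    apply Subtype.ext
    simp only [antidiagHomotopyFun, ContinuousMap.comp_apply]
    refine Prod.ext rfl (Subtype.ext ?_)
    simp [norm_eq_of_mem_sphere, antidiag, antipode, pr₁Compl, pr₁]

/-- **Restriction to the antidiagonal is injective on `Hⁿ` of the complement of the diagonal**
(it is a homotopy equivalence). [cite: MilnorStasheff1974, §11 (proof of Thm. 11.1)] [cite: HatcherAT2002, §3.1 p. 201 (homotopy invariance)] -/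
theorem injective_map_antidiag (n : ℕ) :
    Function.Injective (singularCohomology.map ℤ ℤ (antidiag k) n) := by
  have h : singularCohomology.map ℤ ℤ (antidiag k) n ≫ singularCohomology.map ℤ ℤ (pr₁Compl k) n =
      𝟙 _ := by
    rw [← singularCohomology.map_comp,
      ← singularCohomology.map_eq_of_homotopic_holds ℤ ℤ ⟨antidiagHomotopy k⟩ n,
      singularCohomology.map_id]
  intro a b hab
  have := congrArg (singularCohomology.map ℤ ℤ (pr₁Compl k) n) hab
  rwa [← ModuleCat.comp_apply, ← ModuleCat.comp_apply, h, ModuleCat.id_apply, ModuleCat.id_apply]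
    at this

/-! ### `g₁ + g₂` vanishes off the diagonal (`k` even); `g₁` vanishes off a slice -/

/-- **`(g₁ + g₂)|_{Sᵏ × Sᵏ ∖ Δ} = 0` for `k ≥ 2` even**: on the antidiagonal it restricts to
`γ + antipode^* γ = γ - γ = 0`, and restriction to the antidiagonal is injective. This is the
cohomological shadow of "the diagonal has self-intersection `χ(Sᵏ) = 2`" used to lift `g₁ + g₂`
to a class with support on the diagonal. [cite: MilnorStasheff1974, §11 Thm. 11.1 and Cor. 11.2] [cite: HatcherAT2002, Example 3.11] -/
theorem map_compl_diagonal_g_add_g (hk : 2 ≤ k) (hke : Even k) :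
    singularCohomology.map ℤ ℤ (subsetIncl ((diagonal k)ᶜ)) k (g hk 0 + g hk 1) = 0 := by
  apply injective_map_antidiag
  have e0 : ((pr k 0).comp ((subsetIncl ((diagonal k)ᶜ)).comp (antidiag k))) = ContinuousMap.id _ := by
    ext x : 1; rfl
  have e1 : ((pr k 1).comp ((subsetIncl ((diagonal k)ᶜ)).comp (antidiag k))) = antipode k := by
    ext x : 1; rfl
  have h0 : singularCohomology.map ℤ ℤ (antidiag k) k
      (singularCohomology.map ℤ ℤ (subsetIncl ((diagonal k)ᶜ)) k (g hk 0)) = γ hk := by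
    rw [g, ← ModuleCat.comp_apply, ← ModuleCat.comp_apply, ← singularCohomology.map_comp,
      ← singularCohomology.map_comp, e0, singularCohomology.map_id, ModuleCat.id_apply]
  have h1 : singularCohomology.map ℤ ℤ (antidiag k) k
      (singularCohomology.map ℤ ℤ (subsetIncl ((diagonal k)ᶜ)) k (g hk 1)) = -γ hk := by
    rw [g, ← ModuleCat.comp_apply, ← ModuleCat.comp_apply, ← singularCohomology.map_comp,
      ← singularCohomology.map_comp, e1, map_antipode_γ hk hke]
  rw [map_zero, map_add, map_add, h0, h1, add_neg_cancel]

/-- **`g₁` vanishes off a slice `{p} × Sᵏ`**: on `{q | q.1 ≠ p}` the class `g₁ = pr₁^* γ` factors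
through `Hᵏ(Sᵏ ∖ p; ℤ) = 0`. [cite: HatcherAT2002, Example 3.11 and §3.1 p. 201] -/
theorem map_compl_slice_g_zero (hk : 2 ≤ k) (p : 𝕊 k) :
    singularCohomology.map ℤ ℤ (subsetIncl {q : (𝕊 k) × (𝕊 k) | q.1 ≠ p}) k (g hk 0) = 0 := by
  -- `pr₁ ∘ incl` factors through `S ∖ p`
  let f : C(↥({q : (𝕊 k) × (𝕊 k) | q.1 ≠ p}), ↥(({p}ᶜ : Set (𝕊 k)))) :=
    ⟨fun q => ⟨q.1.1, q.2⟩, by fun_prop⟩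
  have hfac : (pr k 0).comp (subsetIncl {q : (𝕊 k) × (𝕊 k) | q.1 ≠ p}) =
      (subsetIncl (({p}ᶜ : Set (𝕊 k)))).comp f := by
    ext q : 1; rfl
  rw [g, ← ModuleCat.comp_apply, ← singularCohomology.map_comp, hfac, singularCohomology.map_comp,
    ModuleCat.comp_apply]
  haveI := contractibleSpace_compl_singleton (k := k) p
  have h0 : IsZero (singularCohomology ℤ ℤ ↥(({p}ᶜ : Set (𝕊 k))) k) :=
    isZero_singularCohomology_of_contractibleSpace ℤ ℤ _ (by omega)
  rw [h0.eq_of_tgt (singularCohomology.map ℤ ℤ (subsetIncl (({p}ᶜ : Set (𝕊 k)))) k) 0]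
  simp

/-- Symmetrically, **`g₂` vanishes off a slice `Sᵏ × {p}`**. [cite: HatcherAT2002, Example 3.11 and §3.1 p. 201] -/
theorem map_compl_slice_g_one (hk : 2 ≤ k) (p : 𝕊 k) :
    singularCohomology.map ℤ ℤ (subsetIncl {q : (𝕊 k) × (𝕊 k) | q.2 ≠ p}) k (g hk 1) = 0 := by
  let f : C(↥({q : (𝕊 k) × (𝕊 k) | q.2 ≠ p}), ↥(({p}ᶜ : Set (𝕊 k)))) :=
    ⟨fun q => ⟨q.1.2, q.2⟩, by fun_prop⟩
  have hfac : (pr k 1).comp (subsetIncl {q : (𝕊 k) × (𝕊 k) | q.2 ≠ p}) =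
      (subsetIncl (({p}ᶜ : Set (𝕊 k)))).comp f := by
    ext q : 1; rfl
  rw [g, ← ModuleCat.comp_apply, ← singularCohomology.map_comp, hfac, singularCohomology.map_comp,
    ModuleCat.comp_apply]
  haveI := contractibleSpace_compl_singleton (k := k) p
  have h0 : IsZero (singularCohomology ℤ ℤ ↥(({p}ᶜ : Set (𝕊 k))) k) :=
    isZero_singularCohomology_of_contractibleSpace ℤ ℤ _ (by omega)
  rw [h0.eq_of_tgt (singularCohomology.map ℤ ℤ (subsetIncl (({p}ᶜ : Set (𝕊 k)))) k) 0]
  simp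

end SphereProd

end Literature.Topology.FourManifolds

end
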